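import Summits.QuantumFields.YangMills.Theorems.CurvatureSandwichBound.Negative.Unbundled
import Summits.QuantumFields.YangMills.Theorems.IsotropyFromPowerCountingCurvatureSandwichBoundChainEngine
import Summits.QuantumFields.YangMills.Theorems.NPointIsotropy.Negative.NPointRegularJunk
import Literature.MathematicalPhysics.QuantumFieldTheory.OSReconstructionNoE1
import Literature.MathematicalPhysics.QuantumLattice.SchwingerOSCluster
import HarnessLib

/-!
# `SoftKernelBoostCovariance`, line `Sketch`: stub (C) `stub_diagCorePeel` — peeling an `e₀`-chain
of windowed insertions in front of a time-ordered cloud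

Support file for crux stmt-QuantumFields-14999 (`MirrorModularBoosts.SoftKernelBoostCovariance`),
registered skeleton `Cruxes/SoftKernelBoostCovariance/Lines/Sketch.lean` (lead c13 v3.12).  Pure
Osterwalder–Schrader bookkeeping on ONE family `S₁` on `ℝ⁴` with an `e₀`-reconstruction `h` and the
AXIS sandwich bound `SandwichBound S₁ h μ C`.

The chain step is `P⟨m, G⟩ = ⟨2+m, τ_a (J₁ ⊗ (J₂ ⊗ τ_a G))⟩ = (τ_a J₁) ⊗ (τ_a J₂) ⊗ τ_{2a} G` with
two one-slot product-form insertions `Jᵢ = gᵢ(x⁰,x¹)·hhᵢ(x²,x³)` whose translates have times in the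
windows `[α₁, α₁+ℓ]`, `[α₂, α₂+ℓ]` (gaps `γ₁`, `γ₂`, short `ℓ`).  CLAIM (`stub_diagCorePeel`): in
front of a time-ordered cloud `Z` with times `≥ α₁`, every iterate `Pᴺ⟨n, Z⟩` is time-ordered with
times `≥ α₁` and `‖Ψ_{PᴺZ}‖ ≤ (C·Mg·(Mh+Mh')·B)^{2N} ‖Ψ_Z‖`.

PROOF (`DiagPeel.step`, one link; then induction on `N`).  Reserves `u₁ = min(α₁, γ₁/4)`,
`v₁ = min(γ₁/4, 1)`, `u₂ = min(γ₁/2, γ₂/4)`, `v₂ = min(γ₂/4, 1)`.  The link is REBUILT from the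
cloud outwards, `X = τ_{(α₁-u₁)e₀} (f₁ ⊗ τ_{(2u₁+v₁)e₀} W₁)`,
`W₁ = τ_{t₁e₀} (f₂ ⊗ τ_{(2u₂+v₂)e₀} W₂)`, `W₂ = τ_b G`,
with `f₁ = τ_{a-(α₁-u₁)e₀} J₁` (times in `[u₁, 2u₁]`), `f₂ = τ_{a-(α₂-u₂)e₀} J₂` (times in
`[u₂, 2u₂]`), `t₁ = α₂-α₁-u₁-v₁-u₂ ≥ 0`, `b = 2a-(α₂+u₂+v₂)e₀`, `b⁰ ≥ 0` (an identity of test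
functions: `translateMulti_appendTensor`, `translateMulti_translateMulti` and `module` arithmetic in
`ℝ⁴`).  Time-ordering flows outwards (`isTimeOrdered_translateMulti` for the forward shifts,
`isTimeOrdered_head_tail` for the windowed heads); norms flow inwards: forward translations do not
increase norms (`norm_fieldVec_translate_le`: spatial part unitary by `translate_fieldVec`, time
part the contraction `e^{-tH}` by `transfer_fieldVec` + `norm_transfer_le`), and each windowed head
costs `C·Mg·(Mh+Mh')·(uᵢ^{-μ}+vᵢ^{-μ}) ≤ C·Mg·(Mh+Mh')·B` by `SandwichBound` (the translated
insertions are again of product form with the same masses: translation invariance of Lebesgue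
measure on `ℝ²`).

References: K. Osterwalder, R. Schrader, Comm. Math. Phys. 31 (1973) §4.1; J. Glimm, A. Jaffe,
Quantum Physics (1987) §6.1, §10.5 (multiple reflections).
-/

noncomputable section

namespace Summit.QuantumFields.YangMills.Theorems.SoftKernelBoostCovariance.Sketch

open scoped BigOperators SchwartzMap InnerProductSpace
open MeasureTheory Filter Topology
open Literature.MathematicalPhysics.QuantumLattice Literature.MathematicalPhysics.AQFT
  Literature.MathematicalPhysics.QuantumFieldTheory
open Summit.QuantumFields.YangMills.Theorems.NPointIsotropy.Negative (E4)
open Summit.QuantumFields.YangMills.Theorems.CurvatureSandwichBound.Negative (SandwichBound)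
open Summit.QuantumFields.YangMills.Theorems.CurvatureSandwichBound.Sketch
  (tsupport_subset_window timeOrdered_of_head_tail smul_single_apply_zero pairScale_nonneg)

namespace DiagPeel

variable {S₁ : SchwingerFamily E4}

/-- Field vectors of equal test functions coincide. -/
theorem fieldVec_congr_fn (h : OSReconstructionNoE1 S₁.toLabelled) {n : ℕ}
    {F G : 𝓢((Fin n → E4), ℂ)} (hFG : F = G) (hF : IsTimeOrdered F) (hG : IsTimeOrdered G) :
    h.fieldVec n (fun _ => ()) F hF = h.fieldVec n (fun _ => ()) G hG := by
  subst hFG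
  rfl

/-- **Forward translations do not increase norms**: for `b⁰ ≥ 0`, `‖Ψ_{F(· - b)}‖ ≤ ‖Ψ_F‖` — the
spatial part of `b` acts unitarily (`translate_fieldVec`), the time part by the contraction
`e^{-b⁰H}` (`transfer_fieldVec`, `norm_transfer_le`).  Osterwalder–Schrader 1973 §4.1 (4.5), (4.6),
(4.9). -/
theorem norm_fieldVec_translate_le (h : OSReconstructionNoE1 S₁.toLabelled) {n : ℕ}
    (F : 𝓢((Fin n → E4), ℂ)) (hF : IsTimeOrdered F) (b : E4) (hb : 0 ≤ b 0)
    (hbF : IsTimeOrdered (translateMulti b F)) :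
    ‖h.fieldVec n (fun _ => ()) (translateMulti b F) hbF‖ ≤
      ‖h.fieldVec n (fun _ => ()) F hF‖ := by
  have hsp : IsTimeOrdered (translateMulti (spatialPart 0 b) F) :=
    OSReconstructionNoE1.isTimeOrdered_translateMulti hF
      (le_of_eq (OSReconstructionNoE1.spatialPart_zero_apply_zero b).symm)
  have e3 : translateMulti (SchwingerFamily.timeVec (b 0)) (translateMulti (spatialPart 0 b) F) =
      translateMulti b F := by
    rw [translateMulti_translateMulti]
    congr 1
    simp [spatialPart, SchwingerFamily.timeVec]
  have key : h.transfer (b 0) (h.translate b (h.fieldVec n (fun _ => ()) F hF)) =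
      h.fieldVec n (fun _ => ()) (translateMulti b F) hbF := by
    rw [h.translate_fieldVec b n (fun _ => ()) F hF, h.transfer_fieldVec hb n (fun _ => ()) _ hsp]
    exact fieldVec_congr_fn h e3 _ _
  rw [← key]
  exact (h.norm_transfer_le _ _).trans (le_of_eq (LinearIsometryEquiv.norm_map _ _))

/-- Every index of `Fin (1 + m)` lies above the head index. -/
theorem castAdd_zero_le {m : ℕ} (i : Fin (1 + m)) : Fin.castAdd m (0 : Fin 1) ≤ i :=
  Fin.le_def.2 (by simp)

/-- **Head–tail time-ordering**: a one-point head with times in `[lo, hi]`, `0 < lo`, in front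
of the translate by `s e₀`, `hi ≤ s`, of a time-ordered tail is time-ordered (OS 1973 §4.1,
`T^t 𝒮₊ ⊆ 𝒮₊`). -/
theorem isTimeOrdered_head_tail {lo hi s : ℝ} (f : 𝓢((Fin 1 → E4), ℂ))
    (hf : tsupport (f : (Fin 1 → E4) → ℂ) ⊆ {x | lo ≤ x 0 0 ∧ x 0 0 ≤ hi})
    (hlo : 0 < lo) (hs : hi ≤ s) {m : ℕ} (W : 𝓢((Fin m → E4), ℂ)) (hW : IsTimeOrdered W) :
    IsTimeOrdered (f.appendTensor (translateMulti (s • EuclideanSpace.single 0 1) W)) := by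
  intro x hx
  obtain ⟨hxA, hxB⟩ := OSReconstructionNoE1.tsupport_appendTensor_subset _ _ hx
  have hf' : lo ≤ x (Fin.castAdd m 0) 0 ∧ x (Fin.castAdd m 0) 0 ≤ hi := hf hxA
  have hT : (∀ j, 0 < (x (Fin.natAdd 1 j) - s • EuclideanSpace.single 0 1 : E4) 0) ∧
      StrictMono fun j => (x (Fin.natAdd 1 j) - s • EuclideanSpace.single 0 1 : E4) 0 :=
    hW (OSReconstructionNoE1.tsupport_translateMulti_subset _ _ hxB)
  simp only [PiLp.sub_apply, smul_single_apply_zero] at hT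
  refine timeOrdered_of_head_tail x (by linarith [hf'.1]) (fun j => ?_) (fun i j hij => ?_)
  · have := hT.1 j
    linarith [hf'.2]
  · have := hT.2 hij
    simp only at this
    linarith

/-- **Support above the head**: a time-ordered `f ⊗ R` whose head has times `≥ lo` has all its
times `≥ lo`. -/
theorem tsupport_subset_of_head {lo hi : ℝ} (f : 𝓢((Fin 1 → E4), ℂ))
    (hf : tsupport (f : (Fin 1 → E4) → ℂ) ⊆ {x | lo ≤ x 0 0 ∧ x 0 0 ≤ hi}) {m : ℕ}
    (R : 𝓢((Fin m → E4), ℂ)) (hY : IsTimeOrdered (f.appendTensor R)) :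
    tsupport ((f.appendTensor R : 𝓢((Fin (1 + m) → E4), ℂ)) : (Fin (1 + m) → E4) → ℂ)
      ⊆ {x | ∀ i, lo ≤ x i 0} := by
  intro x hx i
  obtain ⟨hxA, -⟩ := OSReconstructionNoE1.tsupport_appendTensor_subset _ _ hx
  have h0 : lo ≤ x (Fin.castAdd m 0) 0 := (hf hxA).1
  have hmono := (hY hx).2.monotone (castAdd_zero_le i)
  simp only at hmono
  show lo ≤ x i 0
  linarith

/-- **Support of a translate**: times `≥ lo` become times `≥ lo + c⁰`. -/
theorem tsupport_translate_subset {lo lo' : ℝ} {m : ℕ} (F : 𝓢((Fin m → E4), ℂ))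
    (hF : tsupport (F : (Fin m → E4) → ℂ) ⊆ {x | ∀ i, lo ≤ x i 0}) (c : E4)
    (hc : lo + c 0 = lo') :
    tsupport ((translateMulti c F : 𝓢((Fin m → E4), ℂ)) : (Fin m → E4) → ℂ) ⊆
      {x | ∀ i, lo' ≤ x i 0} := by
  intro x hx i
  have h1 : ∀ i, lo ≤ (x i - c) 0 :=
    hF (OSReconstructionNoE1.tsupport_translateMulti_subset _ _ hx)
  have h2 := h1 i
  rw [PiLp.sub_apply] at h2
  show lo' ≤ x i 0
  linarith

/-- **Translates of product-form insertions are of product form** (translations without transverse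
part: `c² = c³ = 0`). -/
theorem translate_productForm {J : 𝓢((Fin 1 → E4), ℂ)} {g hh : ℝ × ℝ → ℂ}
    (hJ : ∀ x, J x = g (x 0 0, x 0 1) * hh (x 0 2, x 0 3)) (c : E4) {c₀ c₁ : ℝ}
    (hc0 : c 0 = c₀) (hc1 : c 1 = c₁) (hc2 : c 2 = 0) (hc3 : c 3 = 0) (x : Fin 1 → E4) :
    translateMulti c J x = g (x 0 0 - c₀, x 0 1 - c₁) * hh (x 0 2, x 0 3) := by
  rw [translateMulti_apply, hJ]
  simp only [PiLp.sub_apply, hc0, hc1, hc2, hc3, sub_zero]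

/-- Translation invariance of Lebesgue measure on `ℝ × ℝ`: integrability of a translate. -/
theorem integrable_shift {g : ℝ × ℝ → ℂ} (hg : Integrable g) (c₀ c₁ : ℝ) :
    Integrable (fun p : ℝ × ℝ => g (p.1 - c₀, p.2 - c₁)) :=
  hg.comp_sub_right (c₀, c₁)

/-- Translation invariance of Lebesgue measure on `ℝ × ℝ`: the `L¹` mass of a translate. -/
theorem integral_norm_shift (g : ℝ × ℝ → ℂ) (c₀ c₁ : ℝ) :
    (∫ p : ℝ × ℝ, ‖g (p.1 - c₀, p.2 - c₁)‖) = ∫ p, ‖g p‖ :=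
  integral_sub_right_eq_self (μ := (volume : Measure (ℝ × ℝ))) (fun q => ‖g q‖) (c₀, c₁)

/-- Congruence of the three translation vectors of a chain link. -/
theorem link_congr {m : ℕ} (J₁ J₂ : 𝓢((Fin 1 → E4), ℂ)) (G : 𝓢((Fin m → E4), ℂ))
    {a₁ a₂ a₃ b₁ b₂ b₃ : E4} (h₁ : a₁ = b₁) (h₂ : a₂ = b₂) (h₃ : a₃ = b₃) :
    (translateMulti a₁ J₁).appendTensor
        ((translateMulti a₂ J₂).appendTensor (translateMulti a₃ G)) =
      (translateMulti b₁ J₁).appendTensor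
        ((translateMulti b₂ J₂).appendTensor (translateMulti b₃ G)) := by
  subst h₁ h₂ h₃
  rfl

/-- **One link of the diagonal chain, peeled** (the induction step of `stub_diagCorePeel`).  For
a time-ordered cloud `G`, the link `X = τ_a (J₁ ⊗ (J₂ ⊗ τ_a G))` is time-ordered, has all its times
`≥ α₁`, and `‖Ψ_X‖ ≤ (C·Mg·(Mh+Mh')·B)² ‖Ψ_G‖`: rebuild `X = τ_{(α₁-u₁)e₀}(f₁ ⊗ τ_{(2u₁+v₁)e₀} W₁)`,
`W₁ = τ_{t₁e₀}(f₂ ⊗ τ_{(2u₂+v₂)e₀} τ_b G)`, apply `SandwichBound` to the two windowed heads and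
`norm_fieldVec_translate_le` to the three forward shifts.  Glimm–Jaffe 1987 §10.5. -/
theorem step (h : OSReconstructionNoE1 S₁.toLabelled) {μ C : ℝ} (hC : 0 < C)
    (hSB : SandwichBound S₁ h μ C) (a : E4) (J₁ J₂ : 𝓢((Fin 1 → E4), ℂ))
    (g₁ g₂ hh₁ hh₂ : ℝ × ℝ → ℂ) {Mg Mh Mh' α₁ α₂ ℓ γ₁ γ₂ B : ℝ}
    (ha2 : a 2 = 0) (ha3 : a 3 = 0)
    (hJ₁ : ∀ x, J₁ x = g₁ (x 0 0, x 0 1) * hh₁ (x 0 2, x 0 3))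
    (hJ₂ : ∀ x, J₂ x = g₂ (x 0 0, x 0 1) * hh₂ (x 0 2, x 0 3))
    (hg₁i : Integrable g₁) (hg₂i : Integrable g₂) (hg₁M : (∫ p, ‖g₁ p‖) ≤ Mg)
    (hg₂M : (∫ p, ‖g₂ p‖) ≤ Mg) (hh₁i : Integrable hh₁) (hh₂i : Integrable hh₂)
    (hh₁M : (∫ p, ‖hh₁ p‖) ≤ Mh) (hh₂M : (∫ p, ‖hh₂ p‖) ≤ Mh)
    (hh₁' : ∀ p, ‖hh₁ p‖ ≤ Mh') (hh₂' : ∀ p, ‖hh₂ p‖ ≤ Mh')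
    (hw₁ : ∀ p, g₁ p ≠ 0 → α₁ ≤ p.1 + a 0 ∧ p.1 + a 0 ≤ α₁ + ℓ)
    (hw₂ : ∀ p, g₂ p ≠ 0 → α₂ ≤ p.1 + a 0 ∧ p.1 + a 0 ≤ α₂ + ℓ)
    (hα₁ : 0 < α₁) (hℓ : 0 ≤ ℓ) (hγ₁ : 0 < γ₁) (hγ₂ : 0 < γ₂) (hγ₁4 : γ₁ ≤ 4)
    (hγ₂4 : γ₂ ≤ 4) (hℓα : ℓ ≤ α₁) (h4ℓ₁ : 4 * ℓ ≤ γ₁) (h4ℓ₂ : 4 * ℓ ≤ γ₂)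
    (hgap₁ : α₁ + ℓ + γ₁ ≤ α₂) (hper : α₂ + γ₂ / 2 ≤ 2 * a 0)
    (hB₁ : (min α₁ (γ₁ / 4)) ^ (-μ) + (min (γ₁ / 4) 1) ^ (-μ) ≤ B)
    (hB₂ : (min (γ₁ / 2) (γ₂ / 4)) ^ (-μ) + (min (γ₂ / 4) 1) ^ (-μ) ≤ B)
    {m : ℕ} (G : 𝓢((Fin m → E4), ℂ)) (hG : IsTimeOrdered G) :
    ∃ hX : IsTimeOrdered
        (translateMulti a (J₁.appendTensor (J₂.appendTensor (translateMulti a G)))),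
      tsupport ((translateMulti a (J₁.appendTensor (J₂.appendTensor (translateMulti a G))) :
          𝓢((Fin (1 + (1 + m)) → E4), ℂ)) : (Fin (1 + (1 + m)) → E4) → ℂ) ⊆
        {x | ∀ i, α₁ ≤ x i 0} ∧
      ‖h.fieldVec (1 + (1 + m)) (fun _ => ())
          (translateMulti a (J₁.appendTensor (J₂.appendTensor (translateMulti a G)))) hX‖ ≤
        (C * Mg * (Mh + Mh') * B) ^ 2 * ‖h.fieldVec m (fun _ => ()) G hG‖ := by
  -- the reserves
  obtain ⟨u₁, hu₁def⟩ : ∃ u : ℝ, u = min α₁ (γ₁ / 4) := ⟨_, rfl⟩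
  obtain ⟨v₁, hv₁def⟩ : ∃ v : ℝ, v = min (γ₁ / 4) 1 := ⟨_, rfl⟩
  obtain ⟨u₂, hu₂def⟩ : ∃ u : ℝ, u = min (γ₁ / 2) (γ₂ / 4) := ⟨_, rfl⟩
  obtain ⟨v₂, hv₂def⟩ : ∃ v : ℝ, v = min (γ₂ / 4) 1 := ⟨_, rfl⟩
  rw [← hu₁def, ← hv₁def] at hB₁
  rw [← hu₂def, ← hv₂def] at hB₂
  have hu₁α : u₁ ≤ α₁ := by rw [hu₁def]; exact min_le_left _ _
  have hu₁γ : u₁ ≤ γ₁ / 4 := by rw [hu₁def]; exact min_le_right _ _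
  have hu₁ : 0 < u₁ := by rw [hu₁def]; exact lt_min hα₁ (by linarith)
  have hv₁γ : v₁ ≤ γ₁ / 4 := by rw [hv₁def]; exact min_le_left _ _
  have hv₁1 : v₁ ≤ 1 := by rw [hv₁def]; exact min_le_right _ _
  have hv₁ : 0 < v₁ := by rw [hv₁def]; exact lt_min (by linarith) one_pos
  have hu₂γ₁ : u₂ ≤ γ₁ / 2 := by rw [hu₂def]; exact min_le_left _ _
  have hu₂γ₂ : u₂ ≤ γ₂ / 4 := by rw [hu₂def]; exact min_le_right _ _
  have hu₂ : 0 < u₂ := by rw [hu₂def]; exact lt_min (by linarith) (by linarith)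
  have hv₂γ : v₂ ≤ γ₂ / 4 := by rw [hv₂def]; exact min_le_left _ _
  have hv₂1 : v₂ ≤ 1 := by rw [hv₂def]; exact min_le_right _ _
  have hv₂ : 0 < v₂ := by rw [hv₂def]; exact lt_min (by linarith) one_pos
  have hℓu₁ : ℓ ≤ u₁ := by rw [hu₁def]; exact le_min hℓα (by linarith)
  have hℓu₂ : ℓ ≤ u₂ := by rw [hu₂def]; exact le_min (by linarith) (by linarith)
  have hu₁1 : u₁ ≤ 1 := by linarith
  have hu₂1 : u₂ ≤ 1 := by linarith
  -- the innermost block `W₂ = τ_b G`, `b = 2a − (α₂+u₂+v₂)e₀`, `b⁰ ≥ 0`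
  have hb0 : 0 ≤ (a + a - (α₂ + u₂ + v₂) • EuclideanSpace.single 0 1 : E4) 0 := by
    rw [PiLp.sub_apply, PiLp.add_apply, smul_single_apply_zero]
    linarith
  have hW₂ := OSReconstructionNoE1.isTimeOrdered_translateMulti hG hb0
  -- the second head `f₂ = τ_{a − (α₂−u₂)e₀} J₂`, times in `[u₂, u₂+ℓ] ⊆ [u₂, 2u₂]`
  have hf₂ : ∀ x : Fin 1 → E4, translateMulti (a - (α₂ - u₂) • EuclideanSpace.single 0 1) J₂ x =
      g₂ (x 0 0 - (a 0 - (α₂ - u₂)), x 0 1 - a 1) * hh₂ (x 0 2, x 0 3) :=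
    translate_productForm hJ₂ _ (by rw [PiLp.sub_apply, smul_single_apply_zero]) (by simp)
      (by simp [ha2]) (by simp [ha3])
  have hwin₂ : ∀ p : ℝ × ℝ, g₂ (p.1 - (a 0 - (α₂ - u₂)), p.2 - a 1) ≠ 0 →
      u₂ ≤ p.1 ∧ p.1 ≤ 2 * u₂ := by
    intro p hp
    have := hw₂ _ hp
    simp only at this
    constructor <;> linarith
  have hf₂s := tsupport_subset_window
    (g := fun p : ℝ × ℝ => g₂ (p.1 - (a 0 - (α₂ - u₂)), p.2 - a 1)) hf₂ hwin₂
  have hY₂ := isTimeOrdered_head_tail (s := 2 * u₂ + v₂) _ hf₂s hu₂ (by linarith) _ hW₂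
  have hSB₂ := hSB u₂ v₂ hu₂ hv₂ hu₂1 hv₂1 _
    (fun p : ℝ × ℝ => g₂ (p.1 - (a 0 - (α₂ - u₂)), p.2 - a 1)) hh₂ Mg Mh Mh' hf₂ hwin₂
    (integrable_shift hg₂i _ _) ((integral_norm_shift g₂ _ _).trans_le hg₂M) hh₂i hh₂M hh₂' m _
    hW₂ hY₂
  -- the middle block `W₁ = τ_{t₁e₀}(f₂ ⊗ …)`, `t₁ = α₂ − α₁ − u₁ − v₁ − u₂ ≥ 0`
  have ht₁ : 0 ≤ ((α₂ - α₁ - u₁ - v₁ - u₂) • EuclideanSpace.single 0 1 : E4) 0 := by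
    rw [smul_single_apply_zero]
    linarith
  have hW₁ := OSReconstructionNoE1.isTimeOrdered_translateMulti hY₂ ht₁
  -- the first head `f₁ = τ_{a − (α₁−u₁)e₀} J₁`, times in `[u₁, u₁+ℓ] ⊆ [u₁, 2u₁]`
  have hf₁ : ∀ x : Fin 1 → E4, translateMulti (a - (α₁ - u₁) • EuclideanSpace.single 0 1) J₁ x =
      g₁ (x 0 0 - (a 0 - (α₁ - u₁)), x 0 1 - a 1) * hh₁ (x 0 2, x 0 3) :=
    translate_productForm hJ₁ _ (by rw [PiLp.sub_apply, smul_single_apply_zero]) (by simp)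
      (by simp [ha2]) (by simp [ha3])
  have hwin₁ : ∀ p : ℝ × ℝ, g₁ (p.1 - (a 0 - (α₁ - u₁)), p.2 - a 1) ≠ 0 →
      u₁ ≤ p.1 ∧ p.1 ≤ 2 * u₁ := by
    intro p hp
    have := hw₁ _ hp
    simp only at this
    constructor <;> linarith
  have hf₁s := tsupport_subset_window
    (g := fun p : ℝ × ℝ => g₁ (p.1 - (a 0 - (α₁ - u₁)), p.2 - a 1)) hf₁ hwin₁
  have hY₁ := isTimeOrdered_head_tail (s := 2 * u₁ + v₁) _ hf₁s hu₁ (by linarith) _ hW₁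
  have hSB₁ := hSB u₁ v₁ hu₁ hv₁ hu₁1 hv₁1 _
    (fun p : ℝ × ℝ => g₁ (p.1 - (a 0 - (α₁ - u₁)), p.2 - a 1)) hh₁ Mg Mh Mh' hf₁ hwin₁
    (integrable_shift hg₁i _ _) ((integral_norm_shift g₁ _ _).trans_le hg₁M) hh₁i hh₁M hh₁' _ _
    hW₁ hY₁
  -- the outermost shift `X = τ_{(α₁−u₁)e₀}(f₁ ⊗ …)`
  have ht₀ : 0 ≤ ((α₁ - u₁) • EuclideanSpace.single 0 1 : E4) 0 := by
    rw [smul_single_apply_zero]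
    linarith
  have hX' := OSReconstructionNoE1.isTimeOrdered_translateMulti hY₁ ht₀
  -- the identity of test functions
  have idX : translateMulti a (J₁.appendTensor (J₂.appendTensor (translateMulti a G))) =
      translateMulti ((α₁ - u₁) • EuclideanSpace.single 0 1)
        ((translateMulti (a - (α₁ - u₁) • EuclideanSpace.single 0 1) J₁).appendTensor
          (translateMulti ((2 * u₁ + v₁) • EuclideanSpace.single 0 1)
            (translateMulti ((α₂ - α₁ - u₁ - v₁ - u₂) • EuclideanSpace.single 0 1)
              ((translateMulti (a - (α₂ - u₂) • EuclideanSpace.single 0 1) J₂).appendTensor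
                (translateMulti ((2 * u₂ + v₂) • EuclideanSpace.single 0 1)
                  (translateMulti (a + a - (α₂ + u₂ + v₂) • EuclideanSpace.single 0 1) G)))))) := by
    simp only [translateMulti_appendTensor, translateMulti_translateMulti]
    exact link_congr J₁ J₂ G (by module) (by module) (by module)
  have hX : IsTimeOrdered
      (translateMulti a (J₁.appendTensor (J₂.appendTensor (translateMulti a G)))) := by
    rw [idX]
    exact hX'
  have hX's := tsupport_translate_subset (lo' := α₁) _ (tsupport_subset_of_head _ hf₁s _ hY₁)
    ((α₁ - u₁) • EuclideanSpace.single 0 1) (by rw [smul_single_apply_zero]; ring)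
  refine ⟨hX, ?_, ?_⟩
  · rw [idX]
    exact hX's
  · rw [fieldVec_congr_fn h idX hX hX']
    have hMg0 : 0 ≤ Mg := (integral_nonneg fun _ => norm_nonneg _).trans hg₁M
    have hMh0 : 0 ≤ Mh := (integral_nonneg fun _ => norm_nonneg _).trans hh₁M
    have hMh'0 : 0 ≤ Mh' := (norm_nonneg _).trans (hh₁' 0)
    have hK0 : 0 ≤ C * Mg * (Mh + Mh') := by positivity
    have hΛ₁0 : 0 ≤ C * Mg * (Mh + Mh') * (u₁ ^ (-μ) + v₁ ^ (-μ)) :=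
      pairScale_nonneg hC.le hu₁ hv₁ hg₁M hh₁M hh₁'
    have hΛ₂0 : 0 ≤ C * Mg * (Mh + Mh') * (u₂ ^ (-μ) + v₂ ^ (-μ)) :=
      pairScale_nonneg hC.le hu₂ hv₂ hg₂M hh₂M hh₂'
    have i2 := norm_fieldVec_translate_le h _ hY₁ ((α₁ - u₁) • EuclideanSpace.single 0 1) ht₀ hX'
    have i4 := norm_fieldVec_translate_le h _ hY₂
      ((α₂ - α₁ - u₁ - v₁ - u₂) • EuclideanSpace.single 0 1) ht₁ hW₁
    have i6 := norm_fieldVec_translate_le h G hG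
      (a + a - (α₂ + u₂ + v₂) • EuclideanSpace.single 0 1) hb0 hW₂
    have j1 := i4.trans (hSB₂.trans (mul_le_mul_of_nonneg_left i6 hΛ₂0))
    have j2 := i2.trans (hSB₁.trans (mul_le_mul_of_nonneg_left j1 hΛ₁0))
    refine j2.trans ?_
    have hΛ₁ : C * Mg * (Mh + Mh') * (u₁ ^ (-μ) + v₁ ^ (-μ)) ≤ C * Mg * (Mh + Mh') * B :=
      mul_le_mul_of_nonneg_left hB₁ hK0
    have hΛ₂ : C * Mg * (Mh + Mh') * (u₂ ^ (-μ) + v₂ ^ (-μ)) ≤ C * Mg * (Mh + Mh') * B :=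
      mul_le_mul_of_nonneg_left hB₂ hK0
    have hKB : 0 ≤ C * Mg * (Mh + Mh') * B := hΛ₁0.trans hΛ₁
    calc C * Mg * (Mh + Mh') * (u₁ ^ (-μ) + v₁ ^ (-μ)) *
          (C * Mg * (Mh + Mh') * (u₂ ^ (-μ) + v₂ ^ (-μ)) * ‖h.fieldVec m (fun _ => ()) G hG‖)
        ≤ C * Mg * (Mh + Mh') * B * (C * Mg * (Mh + Mh') * B * ‖h.fieldVec m (fun _ => ()) G hG‖) :=
          mul_le_mul hΛ₁ (mul_le_mul_of_nonneg_right hΛ₂ (norm_nonneg _)) (by positivity) hKB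
      _ = (C * Mg * (Mh + Mh') * B) ^ 2 * ‖h.fieldVec m (fun _ => ()) G hG‖ := by ring

end DiagPeel

/-- **Stub (C) `stub_diagCorePeel` — PEELING AN `e₀`-CHAIN OF WINDOWED INSERTIONS IN FRONT OF A
TIME-ORDERED CLOUD** (model-blind OS bookkeeping).  `S₁` with an `e₀`-reconstruction `h` and the
axis sandwich bound `SandwichBound S₁ h μ C` (`μ ≥ 0`, `C > 0`).  Chain step
`P⟨m, G⟩ = ⟨2+m, τ_a(J₁ ⊗ (J₂ ⊗ τ_a G))⟩` with a translation `a` without transverse part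
(`a₂ = a₃ = 0`), one-slot insertions `Jᵢ = gᵢ(x₀,x₁)·hhᵢ(x₂,x₃)` (`∫|gᵢ| ≤ Mg`, `∫|hhᵢ| ≤ Mh`,
`|hhᵢ| ≤ Mh'`) whose translates `τ_a Jᵢ` have times in the windows `[α₁, α₁+ℓ]`, `[α₂, α₂+ℓ]`
(`0 < α₁`, gap `γ₁`: `α₁+ℓ+γ₁ ≤ α₂`, gap `γ₂` to the next period: `α₂+ℓ+γ₂ ≤ α₁+2a₀`, short
insertions `ℓ ≤ α₁, 4ℓ ≤ γᵢ`, `γᵢ ≤ 4`, `α₂ + γ₂/2 ≤ 2a₀`).  Then for every time-ordered cloud `Z`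
with all times `≥ α₁` and every `N`, `Pᴺ⟨n, Z⟩` is time-ordered with all times `≥ α₁` and
`‖Ψ_{PᴺZ}‖ ≤ (C·Mg·(Mh+Mh')·B)^{2N} ‖Ψ_Z‖` whenever `B` dominates the two reserve sums
`min(α₁,γ₁/4)^{-μ} + min(γ₁/4,1)^{-μ}` and `min(γ₁/2,γ₂/4)^{-μ} + min(γ₂/4,1)^{-μ}`.  Induction on
`N` with `DiagPeel.step` (Osterwalder–Schrader 1973 §4.1; Glimm–Jaffe 1987 §10.5). -/
theorem stub_diagCorePeel :
    open Literature.MathematicalPhysics.QuantumLattice Literature.MathematicalPhysics.AQFT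
      Literature.MathematicalPhysics.QuantumFieldTheory
      Summit.QuantumFields.YangMills.Theorems.CurvatureSandwichBound.Negative
      Summit.QuantumFields.YangMills.Theorems.NPointIsotropy.Negative in
    ∀ (S₁ : SchwingerFamily E4) (h : OSReconstructionNoE1 S₁.toLabelled) (μ C : ℝ), 0 ≤ μ → 0 < C →
      SandwichBound S₁ h μ C →
    ∀ (a : E4) (J₁ J₂ : SchwartzMap (Fin 1 → E4) ℂ) (g₁ g₂ hh₁ hh₂ : ℝ × ℝ → ℂ)
      (Mg Mh Mh' α₁ α₂ ℓ γ₁ γ₂ B : ℝ),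
      a 2 = 0 → a 3 = 0 →
      (∀ x, J₁ x = g₁ (x 0 0, x 0 1) * hh₁ (x 0 2, x 0 3)) →
      (∀ x, J₂ x = g₂ (x 0 0, x 0 1) * hh₂ (x 0 2, x 0 3)) →
      MeasureTheory.Integrable g₁ → MeasureTheory.Integrable g₂ →
      (∫ p, ‖g₁ p‖) ≤ Mg → (∫ p, ‖g₂ p‖) ≤ Mg → 0 < Mg →
      MeasureTheory.Integrable hh₁ → MeasureTheory.Integrable hh₂ →
      (∫ p, ‖hh₁ p‖) ≤ Mh → (∫ p, ‖hh₂ p‖) ≤ Mh → (∀ p, ‖hh₁ p‖ ≤ Mh') → (∀ p, ‖hh₂ p‖ ≤ Mh') →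
      (∀ p, g₁ p ≠ 0 → α₁ ≤ p.1 + a 0 ∧ p.1 + a 0 ≤ α₁ + ℓ) →
      (∀ p, g₂ p ≠ 0 → α₂ ≤ p.1 + a 0 ∧ p.1 + a 0 ≤ α₂ + ℓ) →
      0 < α₁ → 0 ≤ ℓ → 0 < γ₁ → 0 < γ₂ → γ₁ ≤ 4 → γ₂ ≤ 4 → ℓ ≤ α₁ → 4 * ℓ ≤ γ₁ → 4 * ℓ ≤ γ₂ →
      α₁ + ℓ + γ₁ ≤ α₂ → α₂ + ℓ + γ₂ ≤ α₁ + 2 * a 0 → α₂ + γ₂ / 2 ≤ 2 * a 0 →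
      (min α₁ (γ₁ / 4)) ^ (-μ) + (min (γ₁ / 4) 1) ^ (-μ) ≤ B →
      (min (γ₁ / 2) (γ₂ / 4)) ^ (-μ) + (min (γ₂ / 4) 1) ^ (-μ) ≤ B →
    ∀ (P : (Σ m : ℕ, SchwartzMap (Fin m → E4) ℂ) → (Σ m : ℕ, SchwartzMap (Fin m → E4) ℂ)),
      (P = fun Gσ => ⟨1 + (1 + Gσ.1),
        translateMulti a (J₁.appendTensor (J₂.appendTensor (translateMulti a Gσ.2)))⟩) →
    ∀ (n : ℕ) (Z : SchwartzMap (Fin n → E4) ℂ) (hZ : IsTimeOrdered Z),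
      tsupport (Z : (Fin n → E4) → ℂ) ⊆ {x | ∀ i, α₁ ≤ x i 0} →
    ∀ N : ℕ, ∃ hN : IsTimeOrdered (P^[N] ⟨n, Z⟩).2,
      tsupport ((P^[N] ⟨n, Z⟩).2 : (Fin (P^[N] ⟨n, Z⟩).1 → E4) → ℂ) ⊆ {x | ∀ i, α₁ ≤ x i 0} ∧
      ‖h.fieldVec (P^[N] ⟨n, Z⟩).1 (fun _ => ()) (P^[N] ⟨n, Z⟩).2 hN‖ ≤
        (C * Mg * (Mh + Mh') * B) ^ (2 * N) * ‖h.fieldVec n (fun _ => ()) Z hZ‖ := by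
  intro S₁ h μ C _ hC hSB a J₁ J₂ g₁ g₂ hh₁ hh₂ Mg Mh Mh' α₁ α₂ ℓ γ₁ γ₂ B ha2 ha3 hJ₁ hJ₂ hg₁i hg₂i
    hg₁M hg₂M _ hh₁i hh₂i hh₁M hh₂M hh₁' hh₂' hw₁ hw₂ hα₁ hℓ hγ₁ hγ₂ hγ₁4 hγ₂4 hℓα h4ℓ₁ h4ℓ₂
    hgap₁ _ hper hB₁ hB₂ P hP n Z hZ hZs N
  subst hP
  induction N with
  | zero =>
    refine ⟨hZ, hZs, ?_⟩
    show ‖h.fieldVec n (fun _ => ()) Z hZ‖ ≤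
      (C * Mg * (Mh + Mh') * B) ^ (2 * 0) * ‖h.fieldVec n (fun _ => ()) Z hZ‖
    rw [mul_zero, pow_zero, one_mul]
  | succ N ih =>
    obtain ⟨hN, -, hbd⟩ := ih
    rw [Function.iterate_succ_apply']
    have hstep := DiagPeel.step h hC hSB a J₁ J₂ g₁ g₂ hh₁ hh₂ ha2 ha3 hJ₁ hJ₂ hg₁i
      hg₂i hg₁M hg₂M hh₁i hh₂i hh₁M hh₂M hh₁' hh₂' hw₁ hw₂ hα₁ hℓ hγ₁ hγ₂ hγ₁4 hγ₂4 hℓα h4ℓ₁ h4ℓ₂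
      hgap₁ hper hB₁ hB₂ _ hN
    obtain ⟨hX, hXs, hbX⟩ := hstep
    refine ⟨hX, hXs, ?_⟩
    refine hbX.trans ?_
    calc (C * Mg * (Mh + Mh') * B) ^ 2 * ‖h.fieldVec _ (fun _ => ()) _ hN‖
        ≤ (C * Mg * (Mh + Mh') * B) ^ 2 *
            ((C * Mg * (Mh + Mh') * B) ^ (2 * N) * ‖h.fieldVec n (fun _ => ()) Z hZ‖) :=
          mul_le_mul_of_nonneg_left hbd (sq_nonneg _)
      _ = (C * Mg * (Mh + Mh') * B) ^ (2 * (N + 1)) * ‖h.fieldVec n (fun _ => ()) Z hZ‖ := by ring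

end Summit.QuantumFields.YangMills.Theorems.SoftKernelBoostCovariance.Sketch

end
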